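import Summits.Ventures.GridStability.Bench.WSCC9SP9SlabRoa
import Summits.Ventures.GridStability.Lyapunov.WSCC9SP9SlabKData

/-!
# GridStability/Bench/WSCC9SP9SlabKRoa — «G2.b-SP9-SLAB-K»: the SP9 slab certificate with PRINTED-CLASS
# load-bus damping (lineage K of the ★ #45 canary), kernel-checked, and its certified region

Cell `gridfusion` (LADDER-GRIDFUSION), SP–Lur'e lane; seat gridfusion-model-2 (g7); MODEL-VALIDITY Q-MV-3 / v0.42
(«the declared bus value 1/10 of ★ #45 is 10–14× the MAXIMUM of the printed static-load frequency class»). NOT OF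
RECORD unless the lead says so. OBJECT: `WSCC9SP.relLurie DK` (Models/WSCC9SPLurie.lean p498695: the 9-node
structure-preserving WSCC instance, post-fault network B, column V1, relative to bus 9; 11 states `Fin 8 ⊕ Fin 3`,
8 lines) for the DECLARED vector `DK = DKQ` of `Lyapunov/WSCC9SP9SlabKData`: LOAD buses 5/6/8 `K_pf·P_L/ω_B` with
`K_pf = 1` [cite: Kundur1994, §7.1.1 eq. (7.3)] («Typically, K_pf ranges from 0 to 3.0»; per-unit `Δf = δ̇/ω_B`,
Bergen–Hill `P_L = P_L0 + D·δ̇` [cite: Padiyar2013, §2.2.3 eqs. (2.20)–(2.21)]) = `5/1508, 9/3770, 1/377`; TRANSIT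
buses 4/7/9 declared regularisation `1/377` (the printed class gives `0` there — Bergen–Hill's `D_i > 0` device);
machines `(1/10, 1/5, 3/10)·M` (S&P Ex. 7.1, MV-SPD) as in ★ #45. Same certificate CLASS as ★ #45 (slab `u = 1/4`,
`γ_lo = 97/200`, `a = 7/10`, `b = 1`, `η = 1/1000`); Popov cap `λ ≤ 10` (the lever that made the class feasible at
these coefficients: `λ ≤ 1` fails; STATUS RUN line 2026-08-27T11:55:54Z, kit j277838 / j277873).
WHAT IS PROVED: (1) `(WSCC9SP.relLurie DK).A/B/C` are casts of explicit rational matrices (`AK_eq`, `BK_eq`, `CK_eq`;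
`e1`, `e2`, `edgeIncQ`, `CQ`, `edgeInc_eq` REUSED from `Bench/WSCC9SP9SlabRoa` p504776 — nothing object-independent is
restated); (2) the slab blocks over `ℚ` EQUAL the decided `M2Kq` (`slabKQ_eq`, one kernel `decide`); (3) `certK :
SlabCertificate (WSCC9SP.relLurie DK)` [cite: Pai1981, §2.16 Theorem [18] eqs. (2.63)–(2.64)] from the two integer Gram
certificates; (4) `sp9K_slab_roa` = `WSCC9SP.slab_roa_of_eps` (p500745) with `u = 1/4`, `γ_lo = 97/200`, `c = cKQ =
78160563/41943040000`. THREE COLUMNS. CERTIFIED: (3)–(4) for MODEL M′_DK, CLASS slab `u = 1/4`, ε-level `cKQ`.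
MODELLED: «MV-3 + lossless + MV-RD(0.046 @ slack G1) + D⟨declared: MV-SPD machines; load buses K_pf = 1 [Kun (7.3)];
transit reg 1/377⟩ + V-frozen(V1) + ω_R = 377 printed + ref bus 9» — a structure-preserving VARIANT of the printed
9-bus, not a 9-bus sentence. VALIDATED: the SDP solve (CLARABEL), the region datum (ε-level, feasibility-grade, not
optimised), and the census of the other three exactly certified D-class cases (K_pf = 3 / reg 1/100 etc., jsons under
HOME/models/sp9-dclass/). Nothing here says the WSCC system or any grid is stable.
-/


noncomputable section

open Set Filter Topology Real Matrix
open Literature.MathematicalPhysics.PowerSystems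
open Literature.MathematicalPhysics.PowerSystems.LyapunovFunctionFamily
open Literature.Computation.Certificates
open Summit.Ventures.GridStability.Models
open Summit.Ventures.GridStability.Models.StructurePreserving
open Summit.Ventures.GridStability.Models.WSCC9SP
open Summit.Ventures.GridStability.Lyapunov.WSCC9SP9SlabK
open Summit.Ventures.GridStability.Bench.WSCC9SP9Slab (e1 e2 edgeIncQ CQ edgeInc_eq)

namespace Summit.Ventures.GridStability.Bench.WSCC9SP9SlabK

/-! ### The declared damping vector and the object -/

/-- The DECLARED lineage-K damping / load-frequency vector over `ℝ` (printed-class loads, see `DKQ`). -/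
def DK : Fin 9 → ℝ := fun v => (DKQ v : ℝ)

/-- `DK > 0`. -/
theorem hDK : ∀ v, 0 < DK v := fun v => by unfold DK; exact_mod_cast DKQ_pos v

/-! ### The relative system's matrices as casts of rational matrices -/

/-- `A` over `ℚ` (same shape as `Params.relA`). -/
def AKQ : Matrix (Fin 8 ⊕ Fin 3) (Fin 8 ⊕ Fin 3) ℚ
  | Sum.inl _, Sum.inl _ => 0
  | Sum.inl i, Sum.inr j => if ref.succAbove i = gnode j then 1 else 0
  | Sum.inr _, Sum.inl _ => 0
  | Sum.inr j, Sum.inr j' => if j = j' then -(DKQ (gnode j) / MQ (gnode j)) else 0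

/-- `B` over `ℚ` (same shape as `Params.relB`). -/
def BKQ : Matrix (Fin 8 ⊕ Fin 3) (Fin 8) ℚ
  | Sum.inl i, e => ((if ref.succAbove i ∈ genS then 0
      else edgeIncQ e (ref.succAbove i) / DKQ (ref.succAbove i)) - edgeIncQ e ref / DKQ ref) * wtV1Q e
  | Sum.inr j, e => edgeIncQ e (gnode j) / MQ (gnode j) * wtV1Q e

/-- `A = AKQ ↦ ℝ`. -/
theorem AK_eq : (WSCC9SP.relLurie DK).A = AKQ.map (Rat.cast : ℚ → ℝ) := by
  ext a b
  rcases a with i | j <;> rcases b with i' | j'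
  · simp [WSCC9SP.relLurie, Params.relLurie, Params.relA, AKQ]
  · by_cases h : ref.succAbove i = gnode j'
    · simp [WSCC9SP.relLurie, Params.relLurie, Params.relA, AKQ, h]
    · simp [WSCC9SP.relLurie, Params.relLurie, Params.relA, AKQ, h]
  · simp [WSCC9SP.relLurie, Params.relLurie, Params.relA, AKQ]
  · by_cases h : j = j'
    · subst h
      simp [WSCC9SP.relLurie, Params.relLurie, Params.relA, AKQ, WSCC9SP.params, DK]
    · simp [WSCC9SP.relLurie, Params.relLurie, Params.relA, AKQ, h]

/-- `B = BKQ ↦ ℝ`. -/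
theorem BK_eq : (WSCC9SP.relLurie DK).B = BKQ.map (Rat.cast : ℚ → ℝ) := by
  ext a e
  rcases a with i | j
  · by_cases h : ref.succAbove i ∈ genS
    · simp [WSCC9SP.relLurie, Params.relLurie, Params.relB, BKQ, WSCC9SP.params, h, DK, wt,
        edgeInc_eq]
    · simp [WSCC9SP.relLurie, Params.relLurie, Params.relB, BKQ, WSCC9SP.params, h, DK, wt,
        edgeInc_eq]
  · simp [WSCC9SP.relLurie, Params.relLurie, Params.relB, BKQ, WSCC9SP.params, wt, edgeInc_eq]

/-- `C = CQ ↦ ℝ`. -/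
theorem CK_eq : (WSCC9SP.relLurie DK).C = CQ.map (Rat.cast : ℚ → ℝ) := by
  ext e b
  rcases b with i | j
  · simp [WSCC9SP.relLurie, Params.relLurie, Params.relC, CQ, edgeInc_eq]
  · simp [WSCC9SP.relLurie, Params.relLurie, Params.relC, CQ]

/-! ### The slab blocks over `ℚ` and the decided identity with `M2Kq` -/

/-- `P` of lineage K over `ℚ`, reindexed to the state type. -/
def PKQ : Matrix (Fin 8 ⊕ Fin 3) (Fin 8 ⊕ Fin 3) ℚ := PKq.submatrix e1 e1

/-- `τ_e·a_e·b_e` with `a_e = 7/10`, `b_e = 1`. -/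
def tabKQ : Fin 8 → ℚ := fun e => tauKQ e * (aKQ * 1)

/-- `τ_e·(a_e + b_e)/2`. -/
def tab2KQ : Fin 8 → ℚ := fun e => tauKQ e * (aKQ + 1) / 2

/-- State block over `ℚ`: `AᵀP + PA + η·1 − Cᵀ·diag(τab)·C`. -/
def L11KQ : Matrix (Fin 8 ⊕ Fin 3) (Fin 8 ⊕ Fin 3) ℚ :=
  AKQᵀ * PKQ + PKQ * AKQ + etaKQ • (1 : Matrix (Fin 8 ⊕ Fin 3) (Fin 8 ⊕ Fin 3) ℚ)
    - CQᵀ * Matrix.diagonal tabKQ * CQ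

/-- Cross block over `ℚ`: `−PB + (CA)ᵀ·diag(λ) + Cᵀ·diag(τ(a+b)/2)`. -/
def L12KQ : Matrix (Fin 8 ⊕ Fin 3) (Fin 8) ℚ :=
  -(PKQ * BKQ) + (CQ * AKQ)ᵀ * Matrix.diagonal lamKQ + CQᵀ * Matrix.diagonal tab2KQ

/-- Channel block over `ℚ`: `−diag(λ)·CB − (diag(λ)·CB)ᵀ − diag τ`. -/
def L22KQ : Matrix (Fin 8) (Fin 8) ℚ :=
  -(Matrix.diagonal lamKQ * (CQ * BKQ)) - (Matrix.diagonal lamKQ * (CQ * BKQ))ᵀ - Matrix.diagonal tauKQ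

set_option maxHeartbeats 400000 in
/-- **The exact certificate matrix**: `−𝓛 = M2Kq` (reindexed), decided in the kernel over `ℚ`. -/
theorem slabKQ_eq : -(Matrix.fromBlocks L11KQ L12KQ L12KQᵀ L22KQ) = M2Kq.submatrix e2 e2 := by
  decide +kernel

/-- `PKQ` is symmetric (kernel). -/
theorem PKQ_transpose : PKQᵀ = PKQ := by
  decide +kernel

/-! ### The certificate data over `ℝ` -/

/-- `P` of lineage K (real). -/
def PK : Matrix (Fin 8 ⊕ Fin 3) (Fin 8 ⊕ Fin 3) ℝ := PKQ.map (Rat.cast : ℚ → ℝ)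
/-- `τ` of lineage K (real). -/
def τK : Fin 8 → ℝ := fun e => (tauKQ e : ℝ)
/-- `λ` of lineage K (real, Popov coefficients). -/
def lamK : Fin 8 → ℝ := fun e => (lamKQ e : ℝ)
/-- lower slopes `a_e = 7/10`. -/
def aK : Fin 8 → ℝ := fun _ => (aKQ : ℝ)
/-- upper slopes `b_e = 1`. -/
def bK : Fin 8 → ℝ := fun _ => 1

/-! ### Cast plumbing -/

/-- `(M·N) ↦ ℝ` = product of the casts (plumbing). -/
private theorem map_mul' {m n o : Type*} [Fintype n] (M : Matrix m n ℚ) (N : Matrix n o ℚ) :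
    (M * N).map (Rat.cast : ℚ → ℝ) = M.map (Rat.cast : ℚ → ℝ) * N.map (Rat.cast : ℚ → ℝ) :=
  Matrix.map_mul (f := Rat.castHom ℝ)

/-- `(M+N) ↦ ℝ` = sum of the casts (plumbing). -/
private theorem map_add' {m n : Type*} (M N : Matrix m n ℚ) :
    (M + N).map (Rat.cast : ℚ → ℝ) = M.map (Rat.cast : ℚ → ℝ) + N.map (Rat.cast : ℚ → ℝ) := by
  ext i j; simp

/-- `(M−N) ↦ ℝ` = difference of the casts (plumbing). -/
private theorem map_sub' {m n : Type*} (M N : Matrix m n ℚ) :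
    (M - N).map (Rat.cast : ℚ → ℝ) = M.map (Rat.cast : ℚ → ℝ) - N.map (Rat.cast : ℚ → ℝ) := by
  ext i j; simp

/-- `(−M) ↦ ℝ` = minus the cast (plumbing). -/
private theorem map_neg' {m n : Type*} (M : Matrix m n ℚ) :
    (-M).map (Rat.cast : ℚ → ℝ) = -M.map (Rat.cast : ℚ → ℝ) := by
  ext i j; simp

/-- transpose commutes with the cast (plumbing, `rfl`). -/
private theorem map_transpose' {m n : Type*} (M : Matrix m n ℚ) :
    Mᵀ.map (Rat.cast : ℚ → ℝ) = (M.map (Rat.cast : ℚ → ℝ))ᵀ := rfl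

/-- `diag(d) ↦ ℝ = diag(d ↦ ℝ)` (plumbing). -/
private theorem map_diagonal' {n : Type*} [DecidableEq n] (d : n → ℚ) :
    (Matrix.diagonal d).map (Rat.cast : ℚ → ℝ) = Matrix.diagonal (fun i => (d i : ℝ)) :=
  Matrix.diagonal_map Rat.cast_zero

/-- `(q·1) ↦ ℝ = (q ↦ ℝ)·1` (plumbing). -/
private theorem map_smul_one' {n : Type*} [DecidableEq n] (q : ℚ) :
    (q • (1 : Matrix n n ℚ)).map (Rat.cast : ℚ → ℝ) = (q : ℝ) • (1 : Matrix n n ℝ) := by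
  ext i j
  by_cases h : i = j
  · subst h; simp
  · simp [h]

/-! ### The blocks of the certificate matrix over `ℝ` are the casts -/

/-- State block. -/
theorem L11K_eq : slabL11 (WSCC9SP.relLurie DK) PK (etaKQ : ℝ) τK aK bK = L11KQ.map (Rat.cast : ℚ → ℝ) := by
  have hd : Matrix.diagonal (fun k => τK k * (aK k * bK k)) = (Matrix.diagonal tabKQ).map (Rat.cast : ℚ → ℝ) := by
    rw [map_diagonal']
    congr 1; funext k; simp [τK, aK, bK, tabKQ]
  rw [slabL11, AK_eq, CK_eq, hd, PK, L11KQ]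
  simp only [map_sub', map_add', map_mul', map_transpose', map_smul_one']

/-- Cross block. -/
theorem L12K_eq : slabL12 (WSCC9SP.relLurie DK) PK lamK τK aK bK = L12KQ.map (Rat.cast : ℚ → ℝ) := by
  have hd1 : Matrix.diagonal lamK = (Matrix.diagonal lamKQ).map (Rat.cast : ℚ → ℝ) := by
    rw [map_diagonal']; rfl
  have hd2 : Matrix.diagonal (fun k => τK k * (aK k + bK k) / 2)
      = (Matrix.diagonal tab2KQ).map (Rat.cast : ℚ → ℝ) := by
    rw [map_diagonal']
    congr 1; funext k; simp [τK, aK, bK, tab2KQ]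
  rw [slabL12, AK_eq, BK_eq, CK_eq, hd1, hd2, PK, L12KQ]
  simp only [map_add', map_neg', map_mul', map_transpose']

/-- Channel block. -/
theorem L22K_eq : slabL22 (WSCC9SP.relLurie DK) lamK τK = L22KQ.map (Rat.cast : ℚ → ℝ) := by
  have hd1 : Matrix.diagonal lamK = (Matrix.diagonal lamKQ).map (Rat.cast : ℚ → ℝ) := by
    rw [map_diagonal']; rfl
  have hd3 : Matrix.diagonal τK = (Matrix.diagonal tauKQ).map (Rat.cast : ℚ → ℝ) := by
    rw [map_diagonal']; rfl
  rw [slabL22, BK_eq, CK_eq, hd1, hd3, L22KQ]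
  simp only [map_sub', map_neg', map_mul', map_transpose']

/-- **`−𝓛` over `ℝ` is the reindexed cast of `M2Kq`.** -/
theorem negK_slabMatrix_eq : -(slabMatrix (WSCC9SP.relLurie DK) PK (etaKQ : ℝ) lamK τK aK bK)
    = (M2Kq.map (Rat.cast : ℚ → ℝ)).submatrix e2 e2 := by
  rw [slabMatrix, L11K_eq, L12K_eq, L22K_eq, ← map_transpose', ← Matrix.fromBlocks_map, ← map_neg',
    slabKQ_eq]
  rfl

/-- `P − ε·1` over `ℝ` is the reindexed cast of `PKq − epsKQ·1`. -/
theorem PK_sub_eq : PK - (epsKQ : ℝ) • (1 : Matrix (Fin 8 ⊕ Fin 3) (Fin 8 ⊕ Fin 3) ℝ)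
    = ((PKq - epsKQ • (1 : Matrix (Fin 11) (Fin 11) ℚ)).map (Rat.cast : ℚ → ℝ)).submatrix e1 e1 := by
  ext i j
  by_cases h : i = j
  · subst h; simp [PK, PKQ]
  · have h' : e1 i ≠ e1 j := fun he => h (e1.injective he)
    simp [PK, PKQ, h, h']

/-! ### The certificate -/

/-- **THE LINEAGE-K SLAB CERTIFICATE** for `WSCC9SP.relLurie DK` (printed-class load damping): lit-6's
`SlabCertificate` with the exact data of `WSCC9SP9SlabKData` (`P` dyadic 2⁻²⁰, `ε = 8307/524288`, `η = 1/1000`,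
`τ`, `λ ≤ 10`, `a = 7/10`, `b = 1`); the two matrix facts come from the kernel-decided integer Gram certificates.
NOT OF RECORD unless the lead says so. [cite: Pai1981, §2.16 Theorem [18] eqs. (2.63)–(2.64); VuTuritsyn2017, §4.2 Lemma 1] -/
def certK : SlabCertificate (WSCC9SP.relLurie DK) where
  P := PK
  ε := (epsKQ : ℝ)
  η := (etaKQ : ℝ)
  τ := τK
  lam := lamK
  a := aK
  b := bK
  P_symm := by
    show (PKQ.map (Rat.cast : ℚ → ℝ))ᵀ = PKQ.map (Rat.cast : ℚ → ℝ)
    rw [← map_transpose', PKQ_transpose]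
  ε_pos := by exact_mod_cast epsK_facts.2.1
  η_pos := by exact_mod_cast epsK_facts.2.2
  P_ge := by
    rw [PK_sub_eq]
    exact (Matrix.posSemidef_submatrix_equiv e1).2 posSemidefK.1
  τ_nonneg := fun e => by unfold τK; exact_mod_cast (multK_nonneg e).1
  lam_nonneg := fun e => by unfold lamK; exact_mod_cast (multK_nonneg e).2
  a_nonneg_of_lam_pos := fun e _ => by unfold aK aKQ; norm_num
  lmi := by
    rw [negK_slabMatrix_eq]
    exact (Matrix.posSemidef_submatrix_equiv e2).2 posSemidefK.2

/-- `a_e = 7/10 ≤ slabSlope(1/4)` (= cos(θ + γ) ≈ 0.70266 exactly rational). -/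
theorem aK_le_slabSlope : ∀ e, certK.a e ≤ (slabSlope (1 / 4) : ℝ) := fun e => by
  show ((aKQ : ℚ) : ℝ) ≤ ((slabSlope (1 / 4) : ℚ) : ℝ)
  exact_mod_cast (show aKQ ≤ slabSlope (1 / 4) by norm_num [aKQ, slabSlope, tauV1])

/-- `1 ≤ b_e`. -/
theorem oneK_le_b : ∀ e, (1 : ℝ) ≤ certK.b e := fun _ => le_refl _

/-- The level passes the ε-test: `2·c ≤ ε·γ_lo²`. -/
theorem hcK : 2 * ((cKQ : ℚ) : ℝ) ≤ certK.ε * (((97 / 200 : ℚ)) : ℝ) ^ 2 := by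
  show 2 * ((cKQ : ℚ) : ℝ) ≤ ((epsKQ : ℚ) : ℝ) * (((97 / 200 : ℚ)) : ℝ) ^ 2
  exact_mod_cast epsK_facts.1

/-! ### The canary sentence -/

/-- **«G2.b-SP9-SLAB-K» (lineage K: PRINTED-CLASS LOAD DAMPING; not of record unless the lead says so) — the
certified region of the structure-preserving WSCC 3-machine model relative to bus 9 with the DECLARED vector `DK`
(load buses `K_pf·P_L/ω_B`, `K_pf = 1` inside Kundur's printed range `[0, 3]`; transit buses regularisation `1/377`;
machines S&P Ex. 7.1 ratios).** For every phase point `y = (δ, ω)` of MODEL M′_DK = `(WSCC9SP.params DK).phaseField`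
whose 8 listed line-angle deviations satisfy `|σ_e − σ*_e| ≤ 97/200` and whose relative state has
`V(relState y) ≤ cKQ = 78160563/41943040000` (`V = xᵀPx + 2Σ λ_e∫F_e`, the slab Lyapunov function of `certK`):
a solution from `y` exists (unique by `phaseSolution_unique`) and EVERY solution keeps `|σ_e(t) − σ*_e| < 2·atan(1/4)`
and `V ≤ cKQ` for all `t ≥ 0`, every bus-angle difference `δ_v − δ_w → δ*_v − δ*_w`, and every machine frequency
deviation `ω_v → 0`. CERTIFIED for MODEL M′_DK, CLASS = slab `u = 1/4` (γ ≈ 28.07°), `γ_lo = 97/200`, ε-level `cKQ`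
(3.3× the ★ #45 canary's); MODELLED «MV-3 + lossless + MV-RD(0.046 @ slack G1) + D⟨declared: MV-SPD machines;
load buses K_pf = 1 [Kun (7.3)], i.e. 5/1508, 9/3770, 1/377; transit buses reg 1/377⟩ + V-frozen(V1) + ω_R = 377
printed + ref bus 9» — a structure-preserving VARIANT of the printed 9-bus whose every damping number now lies in a
PRINTED CLASS except the transit-bus regularisation (MODEL-VALIDITY v0.42); VALIDATED: the SDP (kit j277873) and the
region-size datum. Nothing here says the WSCC system is stable.
[cite: Pai1981, §2.16 Theorem [18] and §4.6–§4.7; VuTuritsyn2017, §4.3 Theorem 1; Kundur1994, §7.1.1 eq. (7.3)] -/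
theorem sp9K_slab_roa {y : (Fin 9 → ℝ) × (Fin 9 → ℝ)}
    (hy : ∀ e, |(y.1 (srcV e) - y.1 (tgtV e)) - (δ₀ (srcV e) - δ₀ (tgtV e))| ≤ ((97 / 200 : ℚ) : ℝ))
    (hyc : certK.V (relState ref gnode δ₀ y) ≤ ((cKQ : ℚ) : ℝ)) :
    (∃ X : ℝ → (Fin 9 → ℝ) × (Fin 9 → ℝ), X 0 = y ∧
        ∀ T : ℝ, ∀ t ∈ Icc 0 T, HasDerivWithinAt X ((WSCC9SP.params DK).phaseField (X t)) (Icc 0 T) t) ∧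
      ∀ X : ℝ → (Fin 9 → ℝ) × (Fin 9 → ℝ), X 0 = y →
        (∀ T : ℝ, ∀ t ∈ Icc 0 T, HasDerivWithinAt X ((WSCC9SP.params DK).phaseField (X t)) (Icc 0 T) t) →
        (∀ t, 0 ≤ t →
            (∀ e, |((X t).1 (srcV e) - (X t).1 (tgtV e)) - (δ₀ (srcV e) - δ₀ (tgtV e))|
              < 2 * Real.arctan ((1 / 4 : ℚ) : ℝ)) ∧
            certK.V (relState ref gnode δ₀ (X t)) ≤ ((cKQ : ℚ) : ℝ)) ∧
          (∀ v w, Tendsto (fun t => (X t).1 v - (X t).1 w) atTop (𝓝 (δ₀ v - δ₀ w))) ∧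
          ∀ v ∈ genS, Tendsto (fun t => (X t).2 v) atTop (𝓝 0) :=
  WSCC9SP.slab_roa_of_eps hDK certK (u := 1 / 4) (γlo := 97 / 200) (by norm_num) (by norm_num)
    (by norm_num) (by norm_num) aK_le_slabSlope oneK_le_b hcK hy hyc

end Summit.Ventures.GridStability.Bench.WSCC9SP9SlabK

end
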